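import Literature.NumberTheory.Rogawski1990.AdelicStableOrbitalEulerG2
import HarnessLib

/-!
# The (G2)-kernel dictionary and product formula on `U(H₂)(𝐀)` FROM THE RELATIVE `K_v`-CONJUGACY CLAUSE at `γ₀` — no regularity
# (row O7, K6-ζ (ζ1), file 1 of 2: singular ∕ semisimple classes of the inner form `G′ = U(H)` and of any pair `(H₁, H₂)`)
(Rogawski, *Automorphic Representations of Unitary Groups in Three Variables* (1990), §3.3 p. 21, §4.3 p. 44, §5.4 (5.4.3) pp. 72–73; Kottwitz,
*Stable trace formula: elliptic singular terms* (1986), Prop. 7.1)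

Topic `NumberTheory/Rogawski1990`; namespace `Literature.NumberTheory.Rogawski1990`.  THEOREMS ONLY: no definition, no named fact, no instance, no notation,
no `sorry`.  Cell `pub/hodgecm-mathlib`, ENGINE T1 (crux H413 = `stmt-HodgeConjecture-24833`), row O7, piece **K6-ζ (ζ1)** (O7 OWNER WORD #10 (2)); the
two-form twin of ★ K6-δ `AdelicStableClassesProductOfKConj`.

THE POINT.  The ★ (G2)-kernel chain on the two-form carrier `MatchingAdeleG₂ L H₁ H₂ γ₀` — `AdelicStableClassesProductG2` (Kottwitz 7.1 absolute form, (ev),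
(inj)) and `AdelicStableOrbitalEulerG2` (the product formula) — asks `IsRegularElt γ₀` ONLY to call ★ `MatchingAdeleG₂.eventually_forall_exists_conj hH₂ hdet hreg`,
Kottwitz's Prop. 7.1 in the RELATIVE `K_v`-form «a.e. `v`, two elements of `K_v = U(H₂)(𝒪_v)` corresponding to `(γ₀)_v` are `K_v`-conjugate».  This file re-proves the
chain with that conclusion as the hypothesis `hKrel` (the ★ text VERBATIM), for ANY `γ₀ ∈ U(H₁)(L⁺)`; the proofs are the ★ ones token for token.  At
SEMISIMPLE `γ₀` the clause is a theorem (★ FILE 3 `eventually_forall_integralConj_cmDatum_of_isSemisimpleElt`, sequel file); at regular `γ₀` the ★ theorems are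
the specialisation `hKrel := MatchingAdeleG₂.eventually_forall_exists_conj hH₂ hdet hreg`.

* §0 `MatchingAdeleG₂.isConj_toLocal_of_eventuallyKConj` — the clause read as the `GL_3`-conjugacy form at a correspondent `γ` (★ K6-β's binder).
* §1 `MatchingAdeleG₂.eventually_exists_mem_conj_of_eventuallyKConj` (Kottwitz 7.1 absolute form), `…eventually_map_toLocal_eq_mk_of_eventuallyKConj` (ev),
  `…eq_of_forall_map_toLocal_eq_of_map_archPart_eq_of_eventuallyKConj` (inj).
* §2 `MatchingAdeleG₂.adelicStableOrbitalSum_eq_finsum_mul_prod_finsum_of_eventuallyKConj`, `…_of_finset_of_eventuallyKConj`.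

HC_CM is proved only modulo the printed citations until rung 0 closes; this file is unconditional (the clause is a hypothesis).

## References
* [Rogawski1990] J. D. Rogawski, *Automorphic Representations of Unitary Groups in Three Variables*, Ann. of Math. Stud. 123 (1990), §3.3 p. 21, §4.3 p. 44,
  §5.4 (5.4.3) pp. 72–73.
* [Kottwitz1986] R. E. Kottwitz, *Stable trace formula: elliptic singular terms*, Math. Ann. 275 (1986), Prop. 7.1, Cor. 7.3.
* [BorelJacquet1979] A. Borel, H. Jacquet, *Automorphic forms and automorphic representations*, PSPM 33.1 (1979), §4.1.
-/

set_option autoImplicit false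

noncomputable section

open NumberField IsDedekindDomain Filter Function MeasureTheory
open scoped Matrix MatrixGroups

namespace Literature.NumberTheory.Rogawski1990

open Literature.NumberTheory.Automorphic Literature.Topology.Algebra.RestrictedProduct Literature.MeasureTheory.Group

/-! ## §0–§1 The clause; Kottwitz 7.1 absolute form; (ev); (inj) -/

section DictionaryG2

variable {L : Type} [Field L] [NumberField L] [IsCMField L] {H₁ H₂ : Matrix (Fin 3) (Fin 3) L}
  {γ₀ : (UnitaryGroup.cmDatum L 3 H₁).Rational}

/-- **The clause in its `GL_3`-conjugacy form at a correspondent `γ ∈ U(H₂)(L⁺)`** (the binder `hKγ` of ★ K6-β `UnramifiedOrbitalUnitFactorSemisimple` at `H₂`): a.e.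
`v`, an integral `g′` with `g′ ∼_{GL} γ_v` is `K_v`-conjugate to `γ_v` (`γ_v` is integral a.e., ★ `eventually_toLocal_mem_cmLocalIntegralLevel`; `(γ₀)_v ↔ γ_v`,
★ `corresponds_toLocal_toAdelic`). [cite: Rogawski1990, §3.3 p. 21; §14.1 p. 232] [cite: Kottwitz1986, Prop. 7.1] -/
theorem MatchingAdeleG₂.isConj_toLocal_of_eventuallyKConj
    (hKrel : ∀ᶠ v in cofinite, ∀ g g' : (UnitaryGroup.cmDatum L 3 H₂).Local v,
      g ∈ UnitaryGroup.cmLocalIntegralLevel L 3 H₂ v → g' ∈ UnitaryGroup.cmLocalIntegralLevel L 3 H₂ v →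
        Corresponds (UnitaryGroup.conjLocal L (IsCMField.complexConj L) v) ((UnitaryGroup.adelicForm L 3 H₁).map (UnitaryGroup.adeleToLocal L v))
          ((UnitaryGroup.adelicForm L 3 H₂).map (UnitaryGroup.adeleToLocal L v)) ((UnitaryGroup.cmDatum L 3 H₁).toLocal v ((UnitaryGroup.cmDatum L 3 H₁).toAdelic γ₀)) g →
        Corresponds (UnitaryGroup.conjLocal L (IsCMField.complexConj L) v) ((UnitaryGroup.adelicForm L 3 H₁).map (UnitaryGroup.adeleToLocal L v))
          ((UnitaryGroup.adelicForm L 3 H₂).map (UnitaryGroup.adeleToLocal L v)) ((UnitaryGroup.cmDatum L 3 H₁).toLocal v ((UnitaryGroup.cmDatum L 3 H₁).toAdelic γ₀)) g' →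
          ∃ k ∈ UnitaryGroup.cmLocalIntegralLevel L 3 H₂ v, k * g * k⁻¹ = g') {γ : (UnitaryGroup.cmDatum L 3 H₂).Rational}
    (hγ : Corresponds (cmConjRingHom L) H₁ H₂ γ₀ γ) :
    ∀ᶠ v in cofinite, ∀ g' : (UnitaryGroup.cmDatum L 3 H₂).Local v, g' ∈ UnitaryGroup.cmLocalIntegralLevel L 3 H₂ v →
      IsConj (g'.val : GL (Fin 3) (UnitaryGroup.LocalRing L v))
        (((UnitaryGroup.cmDatum L 3 H₂).toLocal v ((UnitaryGroup.cmDatum L 3 H₂).toAdelic γ)).val : GL (Fin 3) (UnitaryGroup.LocalRing L v)) →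
        ∃ k ∈ UnitaryGroup.cmLocalIntegralLevel L 3 H₂ v,
          k * (UnitaryGroup.cmDatum L 3 H₂).toLocal v ((UnitaryGroup.cmDatum L 3 H₂).toAdelic γ) * k⁻¹ = g' := by
  filter_upwards [hKrel, eventually_toLocal_mem_cmLocalIntegralLevel ((UnitaryGroup.cmDatum L 3 H₂).toAdelic γ)] with v hv hγint g' hg' hconj
  exact hv _ _ hγint hg' (corresponds_toLocal_toAdelic hγ v) ((corresponds_toLocal_toAdelic hγ v).of_isStablyConj_right (IsConj.symm hconj))

/-- **Kottwitz 7.1, ABSOLUTE form at a rational correspondent, from the RELATIVE clause** (pair-level form of ★ `MatchingAdeleG₂.eventually_exists_mem_conj`, no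
regularity): for `γ₀ ↔ γ ∈ U(H₂)(L⁺)` every matching adèle `p` has `k γ_v k⁻¹ = p_v`, `k ∈ K_v`, a.e. [cite: Rogawski1990, §3.3 p. 21; §5.4 (5.4.3) pp. 72–73] [cite: Kottwitz1986, Prop. 7.1] -/
theorem MatchingAdeleG₂.eventually_exists_mem_conj_of_eventuallyKConj
    (hKrel : ∀ᶠ v in cofinite, ∀ g g' : (UnitaryGroup.cmDatum L 3 H₂).Local v,
      g ∈ UnitaryGroup.cmLocalIntegralLevel L 3 H₂ v → g' ∈ UnitaryGroup.cmLocalIntegralLevel L 3 H₂ v →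
        Corresponds (UnitaryGroup.conjLocal L (IsCMField.complexConj L) v) ((UnitaryGroup.adelicForm L 3 H₁).map (UnitaryGroup.adeleToLocal L v))
          ((UnitaryGroup.adelicForm L 3 H₂).map (UnitaryGroup.adeleToLocal L v)) ((UnitaryGroup.cmDatum L 3 H₁).toLocal v ((UnitaryGroup.cmDatum L 3 H₁).toAdelic γ₀)) g →
        Corresponds (UnitaryGroup.conjLocal L (IsCMField.complexConj L) v) ((UnitaryGroup.adelicForm L 3 H₁).map (UnitaryGroup.adeleToLocal L v))
          ((UnitaryGroup.adelicForm L 3 H₂).map (UnitaryGroup.adeleToLocal L v)) ((UnitaryGroup.cmDatum L 3 H₁).toLocal v ((UnitaryGroup.cmDatum L 3 H₁).toAdelic γ₀)) g' →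
          ∃ k ∈ UnitaryGroup.cmLocalIntegralLevel L 3 H₂ v, k * g * k⁻¹ = g') {γ : (UnitaryGroup.cmDatum L 3 H₂).Rational}
    (hγ : Corresponds (cmConjRingHom L) H₁ H₂ γ₀ γ) (p : MatchingAdeleG₂ L H₁ H₂ γ₀) :
    ∀ᶠ v in cofinite, ∃ k ∈ UnitaryGroup.cmLocalIntegralLevel L 3 H₂ v,
      k * (UnitaryGroup.cmDatum L 3 H₂).toLocal v ((UnitaryGroup.cmDatum L 3 H₂).toAdelic γ) * k⁻¹ = (UnitaryGroup.cmDatum L 3 H₂).toLocal v p.adele := by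
  filter_upwards [hKrel,
    eventually_toLocal_mem_cmLocalIntegralLevel ((UnitaryGroup.cmDatum L 3 H₂).toAdelic γ), eventually_toLocal_mem_cmLocalIntegralLevel p.adele]
    with v hv hγint hpint
  exact hv _ _ hγint hpint (corresponds_toLocal_toAdelic hγ v) (p.corresponds_toLocal v)

/-- **(ev), pair-level form** of ★ `MatchingAdeleG₂.eventually_map_toLocal_eq_mk`: the local class of `c ∈ 𝒞_𝐀(γ₀)` is the base class `[γ_v]` a.e. [cite: Rogawski1990, §3.3 p. 21; §5.4 (5.4.3) pp. 72–73] [cite: Kottwitz1986, Prop. 7.1] -/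
theorem MatchingAdeleG₂.eventually_map_toLocal_eq_mk_of_eventuallyKConj
    (hKrel : ∀ᶠ v in cofinite, ∀ g g' : (UnitaryGroup.cmDatum L 3 H₂).Local v,
      g ∈ UnitaryGroup.cmLocalIntegralLevel L 3 H₂ v → g' ∈ UnitaryGroup.cmLocalIntegralLevel L 3 H₂ v →
        Corresponds (UnitaryGroup.conjLocal L (IsCMField.complexConj L) v) ((UnitaryGroup.adelicForm L 3 H₁).map (UnitaryGroup.adeleToLocal L v))
          ((UnitaryGroup.adelicForm L 3 H₂).map (UnitaryGroup.adeleToLocal L v)) ((UnitaryGroup.cmDatum L 3 H₁).toLocal v ((UnitaryGroup.cmDatum L 3 H₁).toAdelic γ₀)) g →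
        Corresponds (UnitaryGroup.conjLocal L (IsCMField.complexConj L) v) ((UnitaryGroup.adelicForm L 3 H₁).map (UnitaryGroup.adeleToLocal L v))
          ((UnitaryGroup.adelicForm L 3 H₂).map (UnitaryGroup.adeleToLocal L v)) ((UnitaryGroup.cmDatum L 3 H₁).toLocal v ((UnitaryGroup.cmDatum L 3 H₁).toAdelic γ₀)) g' →
          ∃ k ∈ UnitaryGroup.cmLocalIntegralLevel L 3 H₂ v, k * g * k⁻¹ = g') {γ : (UnitaryGroup.cmDatum L 3 H₂).Rational}
    (hγ : Corresponds (cmConjRingHom L) H₁ H₂ γ₀ γ)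
    {c : ConjClasses (UnitaryGroup.cmDatum L 3 H₂).Adelic} (hc : c ∈ MatchingAdeleG₂.classes L H₁ H₂ γ₀) :
    ∀ᶠ v in cofinite, ConjClasses.map ((UnitaryGroup.cmDatum L 3 H₂).toLocal v) c =
      ConjClasses.mk ((UnitaryGroup.cmDatum L 3 H₂).toLocal v ((UnitaryGroup.cmDatum L 3 H₂).toAdelic γ)) := by
  obtain ⟨p, rfl⟩ := hc
  filter_upwards [MatchingAdeleG₂.eventually_exists_mem_conj_of_eventuallyKConj hKrel hγ p] with v hv
  obtain ⟨k, -, hk⟩ := hv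
  rw [conjClasses_map_mk, ConjClasses.mk_eq_mk_iff_isConj]
  exact (isConj_iff.2 ⟨k, hk⟩).symm

/-- **(inj) — the gluing, pair-level form** of ★ `MatchingAdeleG₂.eq_of_forall_map_toLocal_eq_of_map_archPart_eq` (no regularity). [cite: Rogawski1990, §3.3 p. 21; §5.4 (5.4.3) pp. 72–73] [cite: Kottwitz1986, Prop. 7.1] -/
theorem MatchingAdeleG₂.eq_of_forall_map_toLocal_eq_of_map_archPart_eq_of_eventuallyKConj
    (hKrel : ∀ᶠ v in cofinite, ∀ g g' : (UnitaryGroup.cmDatum L 3 H₂).Local v,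
      g ∈ UnitaryGroup.cmLocalIntegralLevel L 3 H₂ v → g' ∈ UnitaryGroup.cmLocalIntegralLevel L 3 H₂ v →
        Corresponds (UnitaryGroup.conjLocal L (IsCMField.complexConj L) v) ((UnitaryGroup.adelicForm L 3 H₁).map (UnitaryGroup.adeleToLocal L v))
          ((UnitaryGroup.adelicForm L 3 H₂).map (UnitaryGroup.adeleToLocal L v)) ((UnitaryGroup.cmDatum L 3 H₁).toLocal v ((UnitaryGroup.cmDatum L 3 H₁).toAdelic γ₀)) g →
        Corresponds (UnitaryGroup.conjLocal L (IsCMField.complexConj L) v) ((UnitaryGroup.adelicForm L 3 H₁).map (UnitaryGroup.adeleToLocal L v))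
          ((UnitaryGroup.adelicForm L 3 H₂).map (UnitaryGroup.adeleToLocal L v)) ((UnitaryGroup.cmDatum L 3 H₁).toLocal v ((UnitaryGroup.cmDatum L 3 H₁).toAdelic γ₀)) g' →
          ∃ k ∈ UnitaryGroup.cmLocalIntegralLevel L 3 H₂ v, k * g * k⁻¹ = g')
    {c c' : ConjClasses (UnitaryGroup.cmDatum L 3 H₂).Adelic}
    (hc : c ∈ MatchingAdeleG₂.classes L H₁ H₂ γ₀) (hc' : c' ∈ MatchingAdeleG₂.classes L H₁ H₂ γ₀)
    (hv : ∀ v : HeightOneSpectrum (𝓞 ↥(maximalRealSubfield L)),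
      ConjClasses.map ((UnitaryGroup.cmDatum L 3 H₂).toLocal v) c = ConjClasses.map ((UnitaryGroup.cmDatum L 3 H₂).toLocal v) c')
    (ha : ConjClasses.map (UnitaryGroup.archPart (↥(maximalRealSubfield L)) L (IsCMField.complexConj L) 3 H₂) c =
      ConjClasses.map (UnitaryGroup.archPart (↥(maximalRealSubfield L)) L (IsCMField.complexConj L) 3 H₂) c') :
    c = c' := by
  obtain ⟨p, rfl⟩ := hc
  obtain ⟨p', rfl⟩ := hc'
  dsimp only at hv ha ⊢
  rw [ConjClasses.mk_eq_mk_iff_isConj]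
  have ha' : IsConj (UnitaryGroup.archPart (↥(maximalRealSubfield L)) L (IsCMField.complexConj L) 3 H₂ p.adele)
      (UnitaryGroup.archPart (↥(maximalRealSubfield L)) L (IsCMField.complexConj L) 3 H₂ p'.adele) :=
    ConjClasses.mk_eq_mk_iff_isConj.1 ha
  have hv' : ∀ v : HeightOneSpectrum (𝓞 ↥(maximalRealSubfield L)),
      IsConj ((UnitaryGroup.cmDatum L 3 H₂).toLocal v p.adele) ((UnitaryGroup.cmDatum L 3 H₂).toLocal v p'.adele) :=
    fun v => ConjClasses.mk_eq_mk_iff_isConj.1 (hv v)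
  have hK : ∀ᶠ v in cofinite, ∃ k : (UnitaryGroup.cmDatum L 3 H₂).Local v, k ∈ UnitaryGroup.cmLocalIntegralLevel L 3 H₂ v ∧
      k * (UnitaryGroup.cmDatum L 3 H₂).toLocal v p.adele * k⁻¹ = (UnitaryGroup.cmDatum L 3 H₂).toLocal v p'.adele := by
    filter_upwards [hKrel, eventually_toLocal_mem_cmLocalIntegralLevel p.adele,
      eventually_toLocal_mem_cmLocalIntegralLevel p'.adele] with v hKv hint hint'
    obtain ⟨k, hk, hkp⟩ := hKv _ _ hint hint' (p.corresponds_toLocal v) (p'.corresponds_toLocal v)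
    exact ⟨k, hk, hkp⟩
  exact UnitaryGroup.isConj_of_isConj_archPart_of_forall_exists_conj (↥(maximalRealSubfield L)) L (IsCMField.complexConj L) 3 H₂ ha' hv' hK

end DictionaryG2

/-! ## §2 The factored adelic stable sum on `U(H₂)(𝐀)` -/

section Factor

variable {L : Type} [Field L] [NumberField L] [IsCMField L] {H₁ H₂ : Matrix (Fin 3) (Fin 3) L}
  {γ₀ : (UnitaryGroup.cmDatum L 3 H₁).Rational}
  [∀ g : (UnitaryGroup.cmDatum L 3 H₂).Adelic,
    MeasurableSpace ((UnitaryGroup.cmDatum L 3 H₂).Adelic ⧸ Subgroup.centralizer ({g} : Set (UnitaryGroup.cmDatum L 3 H₂).Adelic))]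

/-- **`Σ_{𝒞_𝐀(γ₀)} Φ_m(δ, f) = (Σ_{𝒞_∞} φ_∞) · ∏_{v ∈ S} Σ_{𝒞_v} φ_v` on `U(H₂)(𝐀)`, pair-level form** of ★ `MatchingAdeleG₂.adelicStableOrbitalSum_eq_finsum_mul_prod_finsum`
(the relative `K_v`-conjugacy clause `hKrel` replaces `IsRegularElt γ₀`). [cite: Rogawski1990, §4.3 p. 44; §5.4 (5.4.3) pp. 72–73] [cite: Kottwitz1986, Prop. 7.1] -/
theorem MatchingAdeleG₂.adelicStableOrbitalSum_eq_finsum_mul_prod_finsum_of_eventuallyKConj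
    (hKrel : ∀ᶠ v in cofinite, ∀ g g' : (UnitaryGroup.cmDatum L 3 H₂).Local v,
      g ∈ UnitaryGroup.cmLocalIntegralLevel L 3 H₂ v → g' ∈ UnitaryGroup.cmLocalIntegralLevel L 3 H₂ v →
        Corresponds (UnitaryGroup.conjLocal L (IsCMField.complexConj L) v) ((UnitaryGroup.adelicForm L 3 H₁).map (UnitaryGroup.adeleToLocal L v))
          ((UnitaryGroup.adelicForm L 3 H₂).map (UnitaryGroup.adeleToLocal L v)) ((UnitaryGroup.cmDatum L 3 H₁).toLocal v ((UnitaryGroup.cmDatum L 3 H₁).toAdelic γ₀)) g →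
        Corresponds (UnitaryGroup.conjLocal L (IsCMField.complexConj L) v) ((UnitaryGroup.adelicForm L 3 H₁).map (UnitaryGroup.adeleToLocal L v))
          ((UnitaryGroup.adelicForm L 3 H₂).map (UnitaryGroup.adeleToLocal L v)) ((UnitaryGroup.cmDatum L 3 H₁).toLocal v ((UnitaryGroup.cmDatum L 3 H₁).toAdelic γ₀)) g' →
          ∃ k ∈ UnitaryGroup.cmLocalIntegralLevel L 3 H₂ v, k * g * k⁻¹ = g')
    {γ : (UnitaryGroup.cmDatum L 3 H₂).Rational}
    (hγ : Corresponds (cmConjRingHom L) H₁ H₂ γ₀ γ)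
    (m : OrbitalMeasureFamily (UnitaryGroup.cmDatum L 3 H₂).Adelic)
    (f : (UnitaryGroup.cmDatum L 3 H₂).Adelic → ℂ)
    (φ : ∀ v : HeightOneSpectrum (𝓞 ↥(maximalRealSubfield L)),
      ConjClasses ((UnitaryGroup.cmDatum L 3 H₂).Local v) → ℂ)
    (φₐ : ConjClasses (UnitaryGroup.arch (↥(maximalRealSubfield L)) L (IsCMField.complexConj L) 3
      H₂) → ℂ)
    (S : Finset (HeightOneSpectrum (𝓞 ↥(maximalRealSubfield L))))
    (hfac : ∀ c ∈ MatchingAdeleG₂.classes L H₁ H₂ γ₀, classOrbitalIntegral m f c =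
      φₐ (ConjClasses.map (UnitaryGroup.archPart (↥(maximalRealSubfield L)) L (IsCMField.complexConj L) 3
        H₂) c) *
        ∏ᶠ v, φ v (ConjClasses.map ((UnitaryGroup.cmDatum L 3 H₂).toLocal v) c))
    (h1 : ∀ v ∉ S, φ v (ConjClasses.mk ((UnitaryGroup.cmDatum L 3
      H₂).toLocal v
        ((UnitaryGroup.cmDatum L 3 H₂).toAdelic γ))) = 1)
    (h0 : ∀ v ∉ S, ∀ d, Corresponds (UnitaryGroup.conjLocal L (IsCMField.complexConj L) v)
        ((UnitaryGroup.adelicForm L 3 H₁).map (UnitaryGroup.adeleToLocal L v))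
        ((UnitaryGroup.adelicForm L 3 H₂).map (UnitaryGroup.adeleToLocal L v))
        ((UnitaryGroup.cmDatum L 3 H₁).toLocal v ((UnitaryGroup.cmDatum L 3 H₁).toAdelic γ₀)) (Quotient.out d) →
      d ≠ ConjClasses.mk ((UnitaryGroup.cmDatum L 3
        H₂).toLocal v
          ((UnitaryGroup.cmDatum L 3 H₂).toAdelic γ)) → φ v d = 0)
    (hfin : ∀ v ∈ S, (support (φ v) ∩ {d | Corresponds (UnitaryGroup.conjLocal L (IsCMField.complexConj L) v)
        ((UnitaryGroup.adelicForm L 3 H₁).map (UnitaryGroup.adeleToLocal L v))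
        ((UnitaryGroup.adelicForm L 3 H₂).map (UnitaryGroup.adeleToLocal L v))
        ((UnitaryGroup.cmDatum L 3 H₁).toLocal v ((UnitaryGroup.cmDatum L 3 H₁).toAdelic γ₀)) (Quotient.out d)}).Finite)
    (hfinₐ : (support φₐ ∩ {b | Corresponds (UnitaryGroup.conjMixed (↥(maximalRealSubfield L)) L (IsCMField.complexConj L)) (UnitaryGroup.archFormOf L 3 H₁)
        (UnitaryGroup.archFormOf L 3 H₂)
        (cmRationalToArch L 3 H₁ γ₀) (Quotient.out b)}).Finite) :
    adelicStableOrbitalSum (MatchingAdeleG₂.classes L H₁ H₂ γ₀) m f =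
      (∑ᶠ b ∈ {b | Corresponds (UnitaryGroup.conjMixed (↥(maximalRealSubfield L)) L (IsCMField.complexConj L)) (UnitaryGroup.archFormOf L 3 H₁)
          (UnitaryGroup.archFormOf L 3 H₂)
          (cmRationalToArch L 3 H₁ γ₀) (Quotient.out b)}, φₐ b) *
        ∏ v ∈ S, ∑ᶠ d ∈ {d | Corresponds (UnitaryGroup.conjLocal L (IsCMField.complexConj L) v)
          ((UnitaryGroup.adelicForm L 3 H₁).map (UnitaryGroup.adeleToLocal L v))
          ((UnitaryGroup.adelicForm L 3 H₂).map (UnitaryGroup.adeleToLocal L v))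
          ((UnitaryGroup.cmDatum L 3 H₁).toLocal v ((UnitaryGroup.cmDatum L 3 H₁).toAdelic γ₀)) (Quotient.out d)}, φ v d := by
  rw [adelicStableOrbitalSum_def]
  refine finsum_mem_eq_finsum_mul_prod_finsum_of_factor (MatchingAdeleG₂.classes L H₁ H₂ γ₀)
    (fun c v => ConjClasses.map ((UnitaryGroup.cmDatum L 3
      H₂).toLocal v) c)
    (fun c => ConjClasses.map (UnitaryGroup.archPart (↥(maximalRealSubfield L)) L (IsCMField.complexConj L) 3
      H₂) c)
    (fun v => {d | Corresponds (UnitaryGroup.conjLocal L (IsCMField.complexConj L) v)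
        ((UnitaryGroup.adelicForm L 3 H₁).map (UnitaryGroup.adeleToLocal L v))
        ((UnitaryGroup.adelicForm L 3 H₂).map (UnitaryGroup.adeleToLocal L v))
        ((UnitaryGroup.cmDatum L 3 H₁).toLocal v ((UnitaryGroup.cmDatum L 3 H₁).toAdelic γ₀)) (Quotient.out d)})
    (fun v => ConjClasses.mk ((UnitaryGroup.cmDatum L 3
      H₂).toLocal v
        ((UnitaryGroup.cmDatum L 3 H₂).toAdelic γ)))
    _ (classOrbitalIntegral m f) φ φₐ S (fun v => ?_) ?_ ?_ ?_ ?_ hfac h1 (fun v hv d hd hne => h0 v hv d hd hne) hfin hfinₐ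
  · -- (he) the base class lies in the local stable class
    exact (corresponds_toLocal_toAdelic hγ v).of_isStablyConj_right (isStablyConj_of_isConj (isConj_out_conjClasses_mk _))
  · -- (inj) the gluing
    intro c hc c' hc' h
    have h1' := congrArg Prod.fst h
    have h2' := congrArg Prod.snd h
    exact MatchingAdeleG₂.eq_of_forall_map_toLocal_eq_of_map_archPart_eq_of_eventuallyKConj hKrel hc hc' (fun v => congrFun h1' v) h2'
  · -- (img)
    exact fun c hc => ⟨fun v => MatchingAdeleG₂.corresponds_out_map_toLocal hc v, MatchingAdeleG₂.corresponds_out_map_archPart hc⟩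
  · -- (ev) [Kt₄] 7.1
    exact fun c hc => MatchingAdeleG₂.eventually_map_toLocal_eq_mk_of_eventuallyKConj hKrel hγ hc
  · -- (surj)
    intro δ b hδ hev hb
    obtain ⟨c, hc, hcv, hcb⟩ := MatchingAdeleG₂.exists_mem_classes_of_forall hγ δ b hδ hev hb
    exact ⟨c, hc, funext hcv, hcb⟩

/-- **The same with the factorisation on FINITE sets of places**, pair-level form of ★ `MatchingAdeleG₂.adelicStableOrbitalSum_eq_finsum_mul_prod_finsum_of_finset`.
[cite: Rogawski1990, §4.3 p. 44; §5.4 (5.4.3) pp. 72–73] [cite: Kottwitz1986, Prop. 7.1] -/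
theorem MatchingAdeleG₂.adelicStableOrbitalSum_eq_finsum_mul_prod_finsum_of_finset_of_eventuallyKConj
    (hKrel : ∀ᶠ v in cofinite, ∀ g g' : (UnitaryGroup.cmDatum L 3 H₂).Local v,
      g ∈ UnitaryGroup.cmLocalIntegralLevel L 3 H₂ v → g' ∈ UnitaryGroup.cmLocalIntegralLevel L 3 H₂ v →
        Corresponds (UnitaryGroup.conjLocal L (IsCMField.complexConj L) v) ((UnitaryGroup.adelicForm L 3 H₁).map (UnitaryGroup.adeleToLocal L v))
          ((UnitaryGroup.adelicForm L 3 H₂).map (UnitaryGroup.adeleToLocal L v)) ((UnitaryGroup.cmDatum L 3 H₁).toLocal v ((UnitaryGroup.cmDatum L 3 H₁).toAdelic γ₀)) g →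
        Corresponds (UnitaryGroup.conjLocal L (IsCMField.complexConj L) v) ((UnitaryGroup.adelicForm L 3 H₁).map (UnitaryGroup.adeleToLocal L v))
          ((UnitaryGroup.adelicForm L 3 H₂).map (UnitaryGroup.adeleToLocal L v)) ((UnitaryGroup.cmDatum L 3 H₁).toLocal v ((UnitaryGroup.cmDatum L 3 H₁).toAdelic γ₀)) g' →
          ∃ k ∈ UnitaryGroup.cmLocalIntegralLevel L 3 H₂ v, k * g * k⁻¹ = g')
    {γ : (UnitaryGroup.cmDatum L 3 H₂).Rational}
    (hγ : Corresponds (cmConjRingHom L) H₁ H₂ γ₀ γ)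
    (m : OrbitalMeasureFamily (UnitaryGroup.cmDatum L 3 H₂).Adelic)
    (f : (UnitaryGroup.cmDatum L 3 H₂).Adelic → ℂ)
    (φ : ∀ v : HeightOneSpectrum (𝓞 ↥(maximalRealSubfield L)),
      ConjClasses ((UnitaryGroup.cmDatum L 3 H₂).Local v) → ℂ)
    (φₐ : ConjClasses (UnitaryGroup.arch (↥(maximalRealSubfield L)) L (IsCMField.complexConj L) 3
      H₂) → ℂ)
    (S : Finset (HeightOneSpectrum (𝓞 ↥(maximalRealSubfield L))))
    (hfac : ∀ c ∈ MatchingAdeleG₂.classes L H₁ H₂ γ₀, ∃ S₂ : Finset (HeightOneSpectrum (𝓞 ↥(maximalRealSubfield L))),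
      (∀ v ∉ S₂, φ v (ConjClasses.mk ((UnitaryGroup.cmDatum L 3
        H₂).toLocal v (Quotient.out c))) = 1) ∧
      classOrbitalIntegral m f c =
        φₐ (ConjClasses.mk (UnitaryGroup.archPart (↥(maximalRealSubfield L)) L (IsCMField.complexConj L) 3
          H₂ (Quotient.out c))) *
        ∏ v ∈ S₂, φ v (ConjClasses.mk ((UnitaryGroup.cmDatum L 3 H₂).toLocal v (Quotient.out c))))
    (h1 : ∀ v ∉ S, φ v (ConjClasses.mk ((UnitaryGroup.cmDatum L 3
      H₂).toLocal v
        ((UnitaryGroup.cmDatum L 3 H₂).toAdelic γ))) = 1)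
    (h0 : ∀ v ∉ S, ∀ d, Corresponds (UnitaryGroup.conjLocal L (IsCMField.complexConj L) v)
        ((UnitaryGroup.adelicForm L 3 H₁).map (UnitaryGroup.adeleToLocal L v))
        ((UnitaryGroup.adelicForm L 3 H₂).map (UnitaryGroup.adeleToLocal L v))
        ((UnitaryGroup.cmDatum L 3 H₁).toLocal v ((UnitaryGroup.cmDatum L 3 H₁).toAdelic γ₀)) (Quotient.out d) →
      d ≠ ConjClasses.mk ((UnitaryGroup.cmDatum L 3
        H₂).toLocal v
          ((UnitaryGroup.cmDatum L 3 H₂).toAdelic γ)) → φ v d = 0)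
    (hfin : ∀ v ∈ S, (support (φ v) ∩ {d | Corresponds (UnitaryGroup.conjLocal L (IsCMField.complexConj L) v)
        ((UnitaryGroup.adelicForm L 3 H₁).map (UnitaryGroup.adeleToLocal L v))
        ((UnitaryGroup.adelicForm L 3 H₂).map (UnitaryGroup.adeleToLocal L v))
        ((UnitaryGroup.cmDatum L 3 H₁).toLocal v ((UnitaryGroup.cmDatum L 3 H₁).toAdelic γ₀)) (Quotient.out d)}).Finite)
    (hfinₐ : (support φₐ ∩ {b | Corresponds (UnitaryGroup.conjMixed (↥(maximalRealSubfield L)) L (IsCMField.complexConj L)) (UnitaryGroup.archFormOf L 3 H₁)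
        (UnitaryGroup.archFormOf L 3 H₂)
        (cmRationalToArch L 3 H₁ γ₀) (Quotient.out b)}).Finite) :
    adelicStableOrbitalSum (MatchingAdeleG₂.classes L H₁ H₂ γ₀) m f =
      (∑ᶠ b ∈ {b | Corresponds (UnitaryGroup.conjMixed (↥(maximalRealSubfield L)) L (IsCMField.complexConj L)) (UnitaryGroup.archFormOf L 3 H₁)
          (UnitaryGroup.archFormOf L 3 H₂)
          (cmRationalToArch L 3 H₁ γ₀) (Quotient.out b)}, φₐ b) *
        ∏ v ∈ S, ∑ᶠ d ∈ {d | Corresponds (UnitaryGroup.conjLocal L (IsCMField.complexConj L) v)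
          ((UnitaryGroup.adelicForm L 3 H₁).map (UnitaryGroup.adeleToLocal L v))
          ((UnitaryGroup.adelicForm L 3 H₂).map (UnitaryGroup.adeleToLocal L v))
          ((UnitaryGroup.cmDatum L 3 H₁).toLocal v ((UnitaryGroup.cmDatum L 3 H₁).toAdelic γ₀)) (Quotient.out d)}, φ v d := by
  refine MatchingAdeleG₂.adelicStableOrbitalSum_eq_finsum_mul_prod_finsum_of_eventuallyKConj hKrel hγ m f φ φₐ S (fun c hc => ?_) h1 h0 hfin hfinₐ
  obtain ⟨S₂, hS₂, hc'⟩ := hfac c hc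
  rw [hc', conjClasses_map_eq_mk_out]
  congr 1
  simp_rw [conjClasses_map_eq_mk_out]
  refine (finprod_eq_prod_of_mulSupport_subset _ fun v hv => ?_).symm
  rw [Finset.mem_coe]
  by_contra hvS
  exact hv (hS₂ v hvS)

end Factor

end Literature.NumberTheory.Rogawski1990

end
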